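import Summits.CriticalPhenomena.PercolationContinuityZ3.Theorems.Transplant.GrigorchukTimesZAutGroup
import Summits.CriticalPhenomena.PercolationContinuityZ3.Theorems.Transplant.GrigorchukLamplighterSuperpolynomialGrowth
import Summits.CriticalPhenomena.PercolationContinuityZ3.Theorems.Transplant.GrigorchukCayleyAutNotVirtuallyNilpotent
import HarnessLib

/-!
# `Cay(𝔊 × ℤ; a, b, c, d, z)` is NOT of polynomial growth, hence NO virtually nilpotent group acts on it with finitely many orbits (rung Q's action input absent;
# part V of O19b)

builds on p205010 (kernel theorem, internal audit signed; external expert review pending) — nothing in this file uses p205010; no percolation statement, nothing about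
any `@[conjecture]` (MUST-NOTs stand; `θ(p_c)` on this graph NOT proved in tree or print).  Lane `prim-bschramm`, seat `prim-bschramm-p3` gen 39 (DESIGN OWNER;
`P3-NILPOTENT.md` §32.3/§32.5, item O19b; GO lead g26 #8453, refuter-first).  Helper file (`--supports stmt-CriticalPhenomena-4575 --as helper`).  One def (`gzFibreHom`), no instance.

CONTENT.  The fibre `g ↦ (g, 0)` is an injective graph homomorphism `Cay(𝔊; a,b,c,d) → Cay(𝔊 × ℤ; a,b,c,d,z)`, so balls inject (p638170 `ballVolume_le_of_hom_injective`)
and Grigorchuk's superpolynomial lower bound (p618494/p619845 `not_polynomialGrowth_cayley_gens`) transfers: **`gzCay_not_polynomialGrowth`**.  With «AutCocompactAnyStabilizers»'s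
transfer `AutCyl.exists_polynomialGrowth_of_virtuallyNilpotent_cocompact` (as in N5b p621086): **`gzCay_no_virtuallyNilpotent_finite_orbits`** — no group with a finite-index
nilpotent subgroup acts on `Cay(𝔊 × ℤ; a,b,c,d,z)` by automorphisms with finitely many orbits (the action input of rung Q / `conj4_of_virtuallyNilpotent_cocompact`).
[cite: Grigorchuk1984, Thm. (lower bound)] [cite: WolfGrowth1968, Thm. 3.2] [cite: BenjaminiSchramm1996, Conj. 4; §2 (Cayley graphs)]
-/

noncomputable section

namespace Summit.CriticalPhenomena.PercolationContinuityZ3.Theorems.Transplant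

namespace Grigorchuk

open SimpleGraph Literature.Probability.Percolation Literature.Probability.LatticeModels
open Literature.Barriers.CriticalPhenomena (ballVolume)
open scoped Classical

/-- **The fibre homomorphism** `g ↦ (g, 0)`: `Cay(𝔊; a, b, c, d) →g Cay(𝔊 × ℤ; a, b, c, d, z)`. [cite: BenjaminiSchramm1996, §2 (Cayley graphs)] -/
def gzFibreHom : stdCay →g gzCay where
  toFun g := (g, 1)
  map_rel' {g g'} h := by
    obtain ⟨y, rfl⟩ := stdCay_adj_iff.1 h
    rcases y with _ | ⟨_ | _ | _⟩
    · have e : ((g * Letter.toG .a, 1) : GZ) = (g, 1) * L6.a.toP := Prod.ext rfl (mul_one _).symm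
      rw [e]; exact gzCay_adj_mul _ .a
    · have e : ((g * Letter.toG (.x .b), 1) : GZ) = (g, 1) * L6.b.toP := Prod.ext rfl (mul_one _).symm
      rw [e]; exact gzCay_adj_mul _ .b
    · have e : ((g * Letter.toG (.x .c), 1) : GZ) = (g, 1) * L6.c.toP := Prod.ext rfl (mul_one _).symm
      rw [e]; exact gzCay_adj_mul _ .c
    · have e : ((g * Letter.toG (.x .d), 1) : GZ) = (g, 1) * L6.d.toP := Prod.ext rfl (mul_one _).symm
      rw [e]; exact gzCay_adj_mul _ .d

/-- The fibre homomorphism is injective. [folklore] -/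
theorem gzFibreHom_injective : Function.Injective gzFibreHom := fun _ _ h => (Prod.ext_iff.1 h).1

/-- **`Cay(𝔊 × ℤ; a, b, c, d, z)` IS NOT OF POLYNOMIAL GROWTH — kernel** (no bound `|B(x, n)| ≤ C·(n+1)^D`, real `C`, `D`): Grigorchuk's lower bound along the fibre.
[cite: Grigorchuk1984, Thm. (lower bound)] -/
theorem gzCay_not_polynomialGrowth : ¬ ∃ C D : ℝ, ∀ (x : GZ) (n : ℕ), (ballVolume gzCay x n : ℝ) ≤ C * ((n : ℝ) + 1) ^ D := by
  rintro ⟨C, D, hCD⟩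
  refine not_polynomialGrowth_cayley_gens ({aG, bG, cG, dG} : Finset ↥grigorchukGroup) closure_gens_finset ⟨C, D, fun x n => ?_⟩
  have h := ballVolume_le_of_hom_injective gzFibreHom gzFibreHom_injective x n
  exact (Nat.cast_le.2 h).trans (hCD _ n)

section Action

variable {A : Type} [Group A] [MulAction A GZ]

/-- **NO group with a finite-index NILPOTENT subgroup acts on `Cay(𝔊 × ℤ; a, b, c, d, z)` by automorphisms with finitely many orbits** (such an action forces polynomial
growth — «AutCocompactAnyStabilizers» / Wolf —, against `gzCay_not_polynomialGrowth`).  Rung Q's action input is absent on this graph.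
[cite: WolfGrowth1968, Thm. 3.2] [cite: Grigorchuk1984, Thm. (lower bound)] [cite: BenjaminiSchramm1996, Conj. 4; §2] -/
theorem gzCay_no_virtuallyNilpotent_finite_orbits (hact : IsActionByAut gzCay A) (R : Finset GZ) (hRc : ∀ γ : GZ, ∃ a : A, ∃ r ∈ R, a • r = γ)
    (N : Subgroup A) [N.FiniteIndex] : ¬ Group.IsNilpotent N := by
  intro hN
  exact gzCay_not_polynomialGrowth
    (AutCyl.exists_polynomialGrowth_of_virtuallyNilpotent_cocompact (CayleyScaled.connected_mulCayley_of_closure gzGens closure_gzGens) hact R hRc N)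

/-- **… `Group.IsVirtuallyNilpotent` form.** [cite: WolfGrowth1968, Thm. 3.2] [cite: Grigorchuk1984, Thm. (lower bound)] -/
theorem gzCay_no_isVirtuallyNilpotent_finite_orbits (hact : IsActionByAut gzCay A) (R : Finset GZ) (hRc : ∀ γ : GZ, ∃ a : A, ∃ r ∈ R, a • r = γ) :
    ¬ Group.IsVirtuallyNilpotent A := by
  rintro ⟨K, hK, hfi⟩
  haveI := hfi
  exact gzCay_no_virtuallyNilpotent_finite_orbits hact R hRc K hK

end Action

end Grigorchuk

end Summit.CriticalPhenomena.PercolationContinuityZ3.Theorems.Transplant
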